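/-
Copyright (c) 2026 the pub-hodgecm-mathlib formalisation cell (harness21).  Prover seat hodgecm-mathlib-K2E3-p26 (g2), Track B «K2-LIT» (valve hand → L1),
#184♮ = hLiu418 = `stmt-HodgeConjecture-24832`; socket #41, KIND 1, organ (K1b-W) «KIND W at `n := 1` for the pulled-back family» (line lead K2Liu-p14 (g4), FILE CUT
2026-09-04T22:32:01Z, LINE WORDS #1 (3) ∕ #5), brick (KW1-c) sub-brick (c4) edition 2 «THE LATTICE LETTER IN THE RANK-ONE COORDINATE `b ↦ n(ι_v b · δ)`».
THEOREMS ONLY (no `def`, no `instance`, no notation, no named-fact hypothesis, no `sorry`); lane `--supports stmt-HodgeConjecture-24832` (count-neutral helper; closes no socket by itself).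
-/
import Summits.HodgeConjecture.HodgeConjecture.Theorems.K2LiuKindOneLineLatticeLetter        -- ★ (c4) ed. 1 p862912 (this seat): `v_le_exp_of_integral_mul_addChar_ne_zero` (+ the truncated-ball twin)
import Summits.HodgeConjecture.HodgeConjecture.Theorems.K2LiuUnipDeltaRankOneCoordinates     -- ★ O41.5c rank one (K2Liu-p01): `skew_coord`, `nElem_coord_add` (`n(ι_v(b+b')δ) = n(ι_v b δ)·n(ι_v b' δ)`)
import Summits.HodgeConjecture.HodgeConjecture.Theorems.K2LiuLocalHeightLevelConjugation    -- ★ (c1) p862721 (this seat): `apply_mul_mul_eq_of_forall_conj_mem` (right-invariance of a right translate)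
import HarnessLib

/-!
# Crux `HLiu418`, socket #41, (K1b-W) brick (KW1-c) sub-brick (c4), edition 2 — `K2LiuKindOneLineLatticeLetterCoord`: THE RANK-ONE LATTICE LETTER ALONG `b ↦ n(ι_v b · δ)` —
# `∫ f(w·n(ι_v b δ)·g)·ψ_v(b·ξ) db ≠ 0` AND `n(ι_v b₀ δ) ∈ U` FOR `|b₀|_v ≤ exp(−m)` ⟹ `|ξ|_v ≤ exp(m − d)`

Cell `hodgecm-mathlib`, crux item hLiu418 = `stmt-HodgeConjecture-24832` (helper lane `--supports … --as helper`, count-neutral), route of record `HCCMUnconditional`;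
squad K2 ∕ K2Liu (L1, LEAD F0P6-plan (g14) BATCH #79∕#82), road `K2_Liu`, socket #41, KIND 1, organ (K1b-W) (line lead K2Liu-p14 (g4)), brick (KW1-c): (c1) ★ p862721 ·
(c2) ★ p862738 · HEAD ★ p862891 `K2LiuKindOneLineWhittakerSupport` (`hsupp₁` from the by-value letter `hlat`) · (c4) ed. 1 ★ p862912 `K2LiuKindOneLineLatticeLetter` (the one-variable
core) · THIS FILE = (c4) ed. 2, the core dressed in the line's rank-one coordinate (★ `K2LiuUnipDeltaRankOneCoordinates`, the currency of ★ (KW1-b2) `K2LiuKindOneLineGoodPlaceFactor` and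
★ `K2LiuUnipDeltaRankOneHaar.integral_comp_coord`).  Author K2E3-p26 (g2).

FRAME (★ O41.5c rank one): `E ∕ F` quadratic (`c`, skew `δ`), a finite place `v` of `F`, `H(F_v) = UnitaryGroup.localPi E c (1 + 1) J^𝔻 v`, the unipotent elements
`n(ι_v b · δ) = nElem F E c v 1 hJD (Matrix.of fun _ _ => toLocalRing E v b * algebraMap E (LocalRing E v) δ) (skew_coord …)`, `b ∈ F_v`, additive in `b` (★ `nElem_coord_add`).
* §1 `apply_nElem_coord_add_of_mem` — a right-`U`-invariant `Φ₀ : H(F_v) → ℂ` with `n(ι_v b₀ δ) ∈ U` has `Φ₀(n(ι_v (b + b₀) δ)) = Φ₀(n(ι_v b δ))`;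
  `apply_mul_mul_mul_eq_of_forall_conj_mem` — `y ↦ f(w·y·g)` is right-`U`-invariant when `f` is right-`K`-invariant and `g⁻¹Ug ⊆ K` (★ (c1) `apply_mul_mul_eq_of_forall_conj_mem`; for the
  line `K = K_v(ϖ^c)`, `U = K_v(ϖ^{c+2a})`, `q^a = H_v(g)` ★ (c1) `conj_mem_congruenceGL_of_localHeight_le` + the corner chart's `hιK`).
* §2 **`v_le_exp_of_integral_translate_ne_zero`** — THE LETTER: `Φ₀` right-`U`-invariant, `n(ι_v b₀ δ) ∈ U` whenever `|b₀|_v ≤ exp(−m)`, `ψ` of conductor exponent `d`, `μ` any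
  right-invariant measure on `F_v`: `∫ Φ₀(n(ι_v b δ))·ψ(b·ξ) dμ ≠ 0 ⟹ |ξ|_v ≤ exp(m − d)` (★ (c4) ed. 1); **`v_le_exp_of_integral_mul_translate_ne_zero`** — the same for
  `Φ₀ := y ↦ f(w·y·g)` (full integrals: at `n = 1` the line's local Whittaker integral converges absolutely on `{0 < re s}`, LINE CUT «continued = integral»; the truncated-ball
  form is ★ (c4) ed. 1 `v_le_exp_of_setIntegral_mul_addChar_ne_zero` + `add_mem_ball_iff_of_v_le`).
With the (KW1-b2′) reading of the twist (`ξ = τ(½ S δ)`) and the dictionary `|·|_v ↔ |·|_w` (★ `valued_toPlace`) this is the place-`v` clause of `hlat` in ★ `hsupp_line_of_latticeLetter`.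
[Casselman1980, §3]; [Shimura1997, §18]; [HarrisKudlaSweet1996, §1 (1.11)–(1.12)]; [Tate1950, §2.2].

HONEST LABEL.  Count-neutral helper; it retires nothing by itself: `HC_CM` is proved only modulo the 7 printed citations (2 remaining named inputs:
hLiu418 = `stmt-HodgeConjecture-24832`, h413 = `stmt-HodgeConjecture-24833`) until rung 0 closes.

## References
* [Casselman1980] W. Casselman, *The unramified principal series of p-adic groups I*, Compositio Math. 40 (1980), §3 (lattice support of Whittaker functionals).
* [Shimura1997] G. Shimura, *Euler products and Eisenstein series*, CBMS 93 (1997), §18 (local Whittaker integrals at bad places).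
* [HarrisKudlaSweet1996] M. Harris, S. Kudla, W. J. Sweet, *Theta dichotomy for unitary groups*, J. AMS 9 (1996), §1 (1.11)–(1.12) (`N_Δ ≅ Herm_n`, `n(t)n(t′) = n(t+t′)`).
* [Tate1950] J. Tate, *Fourier analysis in number fields and Hecke's zeta-functions* (1950), in Cassels–Fröhlich (1967), Ch. XV §2.2.
-/

set_option autoImplicit false
-- the mandated namespace repeats the single-problem summit's segment (`HodgeConjecture.HodgeConjecture`)
set_option linter.dupNamespace false

noncomputable section

open scoped NNReal WithZero
open NumberField IsDedekindDomain Matrix MeasureTheory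
open Literature.NumberTheory.Automorphic Literature.NumberTheory.Automorphic.UnitaryGroup
open Literature.NumberTheory.GelbartRogawski1991.UnitaryDualPair.LocalSplitting
open Literature.NumberTheory.K2Lit.LocalSiegelDoubled

namespace Summit.HodgeConjecture.HodgeConjecture.Cruxes.HLiu418.K2LiuKindOneLineLatticeLetterCoord

open Summit.HodgeConjecture.HodgeConjecture.Cruxes.HLiu418.K2LiuUnipDeltaRankOneCoordinates (skew_coord nElem_coord_add)
open Summit.HodgeConjecture.HodgeConjecture.Cruxes.HLiu418.K2LiuKindOneLineLatticeLetter
open Summit.HodgeConjecture.HodgeConjecture.Cruxes.HLiu418.K2LiuLocalHeightLevelConjugation (apply_mul_mul_eq_of_forall_conj_mem)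

variable (F : Type) [Field F] [NumberField F] (E : Type) [Field E] [NumberField E] [Algebra F E]
  (c : E ≃ₐ[F] E) {δ : E} (hcδ : c δ = -δ)
  (v : HeightOneSpectrum (𝓞 F)) {T₀ : Matrix (Fin 1) (Fin 1) F} (hT₀d : IsUnit T₀.det)
  {JD : Matrix (Fin (1 + 1)) (Fin (1 + 1)) E} (hJD : JD = (gramD F 1 T₀).map (algebraMap F E))

/-! ## §1 Right-invariance along the coordinate -/

include hcδ hT₀d hJD in
/-- **`Φ₀(n(ι_v (b + b₀) δ)) = Φ₀(n(ι_v b δ))`** for `Φ₀` right-`U`-invariant and `n(ι_v b₀ δ) ∈ U` (★ `nElem_coord_add`). [cite: HarrisKudlaSweet1996, §1 (1.11)] [cite: Casselman1980, §3] -/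
theorem apply_nElem_coord_add_of_mem (Φ₀ : UnitaryGroup.localPi E c (1 + 1) JD v → ℂ) (U : Subgroup (UnitaryGroup.localPi E c (1 + 1) JD v))
    (hΦU : ∀ y u, u ∈ U → Φ₀ (y * u) = Φ₀ y) {b₀ : v.adicCompletion F}
    (hb₀ : nElem F E c v 1 hJD (Matrix.of fun _ _ : Fin 1 => toLocalRing E v b₀ * algebraMap E (LocalRing E v) δ) (skew_coord F E c hcδ v hT₀d b₀) ∈ U)
    (b : v.adicCompletion F) :
    Φ₀ (nElem F E c v 1 hJD (Matrix.of fun _ _ : Fin 1 => toLocalRing E v (b + b₀) * algebraMap E (LocalRing E v) δ) (skew_coord F E c hcδ v hT₀d (b + b₀))) =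
      Φ₀ (nElem F E c v 1 hJD (Matrix.of fun _ _ : Fin 1 => toLocalRing E v b * algebraMap E (LocalRing E v) δ) (skew_coord F E c hcδ v hT₀d b)) := by
  rw [nElem_coord_add F E c hcδ v hT₀d hJD]
  exact hΦU _ _ hb₀

omit [NumberField F] [NumberField E] in
/-- **`y ↦ f(w·y·g)` is right-`U`-invariant** when `f` is right-`K`-invariant and `g⁻¹ u g ∈ K` for all `u ∈ U` (★ (c1) `apply_mul_mul_eq_of_forall_conj_mem` at the point `w·y`).  For the line:
`K = K_v(ϖ^c)` the level of `f`, `U = K_v(ϖ^{c+2a})` with `q^a = H_v(g)` (★ (c1) `conj_mem_congruenceGL_of_localHeight_le`). [cite: Casselman1980, §3] [cite: BorelJacquet1979, §4.1] -/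
theorem apply_mul_mul_mul_eq_of_forall_conj_mem {G : Type*} [Group G] {Y : Sort*} (f : G → Y) (K : Subgroup G) (hf : ∀ (x : G) (k : G), k ∈ K → f (x * k) = f x)
    (w g : G) (U : Subgroup G) (hU : ∀ u ∈ U, g⁻¹ * u * g ∈ K) (y u : G) (hu : u ∈ U) : f (w * (y * u) * g) = f (w * y * g) := by
  rw [← mul_assoc]
  exact apply_mul_mul_eq_of_forall_conj_mem f K hf g U hU (w * y) u hu

/-! ## §2 The lattice letter along the coordinate -/

section Letter

variable [MeasurableSpace (v.adicCompletion F)] [BorelSpace (v.adicCompletion F)] (μ : Measure (v.adicCompletion F)) [μ.IsAddRightInvariant]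

include hcδ hT₀d hJD in
/-- **THE RANK-ONE LATTICE LETTER ALONG `b ↦ n(ι_v b δ)`**: `Φ₀` right-`U`-invariant, `n(ι_v b₀ δ) ∈ U` whenever `|b₀|_v ≤ exp(−m)`, `ψ` of conductor exponent `d`, `μ` right-invariant:
`∫ Φ₀(n(ι_v b δ))·ψ(b·ξ) dμ(b) ≠ 0 ⟹ |ξ|_v ≤ exp(m − d)` (§1 + ★ (c4) ed. 1 `v_le_exp_of_integral_mul_addChar_ne_zero`). [cite: Casselman1980, §3] [cite: Shimura1997, §18] [cite: Tate1950, §2.2] -/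
theorem v_le_exp_of_integral_translate_ne_zero (Φ₀ : UnitaryGroup.localPi E c (1 + 1) JD v → ℂ) (U : Subgroup (UnitaryGroup.localPi E c (1 + 1) JD v))
    (hΦU : ∀ y u, u ∈ U → Φ₀ (y * u) = Φ₀ y) {m : ℤ}
    (hU : ∀ b₀ : v.adicCompletion F, Valued.v b₀ ≤ WithZero.exp (-m) →
      nElem F E c v 1 hJD (Matrix.of fun _ _ : Fin 1 => toLocalRing E v b₀ * algebraMap E (LocalRing E v) δ) (skew_coord F E c hcδ v hT₀d b₀) ∈ U)
    {ψ : AddChar (v.adicCompletion F) Circle} {d : ℤ} (hψ : ψ.HasConductorExp d) (ξ : v.adicCompletion F)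
    (hI : ∫ b, Φ₀ (nElem F E c v 1 hJD (Matrix.of fun _ _ : Fin 1 => toLocalRing E v b * algebraMap E (LocalRing E v) δ) (skew_coord F E c hcδ v hT₀d b)) *
      ((ψ (b * ξ) : Circle) : ℂ) ∂μ ≠ 0) :
    Valued.v ξ ≤ WithZero.exp (m - d) :=
  v_le_exp_of_integral_mul_addChar_ne_zero v μ hψ ξ (fun b₀ hb₀ b => apply_nElem_coord_add_of_mem F E c hcδ v hT₀d hJD Φ₀ U hΦU (hU b₀ hb₀) b) hI

include hcδ hT₀d hJD in
/-- **THE SAME FOR THE TRANSLATED PULL-BACK `y ↦ f(w·y·g)`**: `f` right-`K`-invariant, `g⁻¹Ug ⊆ K`, `n(ι_v b₀ δ) ∈ U` for `|b₀|_v ≤ exp(−m)`, `ψ` of conductor exponent `d`: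
`∫ f(w·n(ι_v b δ)·g)·ψ(b·ξ) dμ(b) ≠ 0 ⟹ |ξ|_v ≤ exp(m − d)`.  (For the line: `w = w₁` the Weyl element, `g = g_v` the translate, `K = K_v(ϖ^c)`, `U = K_v(ϖ^{c+2a})`, `m = c + 2a` up to the
corner chart's `hιK`.) [cite: Casselman1980, §3] [cite: Shimura1997, §18] [cite: BorelJacquet1979, §4.1] -/
theorem v_le_exp_of_integral_mul_translate_ne_zero (f : UnitaryGroup.localPi E c (1 + 1) JD v → ℂ) (K : Subgroup (UnitaryGroup.localPi E c (1 + 1) JD v))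
    (hf : ∀ x k, k ∈ K → f (x * k) = f x) (w g : UnitaryGroup.localPi E c (1 + 1) JD v) (U : Subgroup (UnitaryGroup.localPi E c (1 + 1) JD v))
    (hUK : ∀ u ∈ U, g⁻¹ * u * g ∈ K) {m : ℤ}
    (hU : ∀ b₀ : v.adicCompletion F, Valued.v b₀ ≤ WithZero.exp (-m) →
      nElem F E c v 1 hJD (Matrix.of fun _ _ : Fin 1 => toLocalRing E v b₀ * algebraMap E (LocalRing E v) δ) (skew_coord F E c hcδ v hT₀d b₀) ∈ U)
    {ψ : AddChar (v.adicCompletion F) Circle} {d : ℤ} (hψ : ψ.HasConductorExp d) (ξ : v.adicCompletion F)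
    (hI : ∫ b, f (w * nElem F E c v 1 hJD (Matrix.of fun _ _ : Fin 1 => toLocalRing E v b * algebraMap E (LocalRing E v) δ) (skew_coord F E c hcδ v hT₀d b) * g) *
      ((ψ (b * ξ) : Circle) : ℂ) ∂μ ≠ 0) :
    Valued.v ξ ≤ WithZero.exp (m - d) :=
  v_le_exp_of_integral_translate_ne_zero F E c hcδ v hT₀d hJD μ (fun y => f (w * y * g)) U
    (fun y u hu => apply_mul_mul_mul_eq_of_forall_conj_mem f K hf w g U hUK y u hu) hU hψ ξ hI

end Letter

end Summit.HodgeConjecture.HodgeConjecture.Cruxes.HLiu418.K2LiuKindOneLineLatticeLetterCoord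

end
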